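import Summits.QuantumFields.YangMills.Theorems.UnitScaleTiltProp7CurvedMemberLocalHessian
import Summits.QuantumFields.YangMills.Theorems.UnitScaleTiltProp7MassiveSolutionGradientSup
import Summits.QuantumFields.YangMills.Theorems.UnitScaleTiltProp7ActionGradCurrentT3
import Summits.QuantumFields.YangMills.Theorems.UnitScaleTiltProp7LandauDictT3
import HarnessLib

/-!
# Route `UnitScaleTilt`, crux K1 «MinimiserStabilityRegPr» (stmt-QuantumFields-19200), EX row (5) `h3` (STOREY H), H-ROAD brick H7, FILE 1∕2 — **THE GAUGE LETTERS OF THE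
# COVARIANT HESSIAN ROW**: the `ν`-slice `S_ν A := toL2S (formComp (toL2⁻¹A) ν)` of a bond field and its intertwining with the conjugation isometries (so the covariant Hessian
# entries `‖(D_{U₀}(S_μ(D_{U₀}u)))(p)‖` are GAUGE INVARIANT), and the two curvature letters of H4–H6 ✓`Prop7CurvedMemberLocalHessian.exists_curved_localHessian` — the plaquette
# window `‖V(∂p) − 1‖ ≤ ε₀η²` (all orientations) and the current `‖J_μ(y)‖ ≤ ε₀` — DISCHARGED on lit's carrier from `RegPr F n K ε₀ V` (both clauses of print's (8)).

Cell `ym3-torus` (HUMAN RULING D-0037; rung R3 = SU(2) YM₃ on T³ — NOT d = 4, NOT infinite volume, NOT a mass gap, NOT Clay).  Width seat `ym3-torus-px13` (gen 16); ★p1 g28 CHAIR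
WORD №46 (H-road, H7 = px13); `--supports stmt-QuantumFields-19200 --as helper`; count-neutral; THEOREMS ONLY (0 `def`, 0 `sorry`, default heartbeats).  Consumer: FILE 2∕2
`…Prop7SolutionHessianSupOfRegPr` (the sup→sup covariant Hessian row, T1-core's pattern one order up).

WHAT IS PROVED (ns `Summit.QuantumFields.YangMills.Theorems.Prop7SolutionHessianLetters`; member `F`, heights `n K`, weight `c₀ > 0`).
* `equiv_slice_apply` — `(S_ν A)(y) = A(y, ν)` (✓`toL2S_apply`, ✓`toL2_symm_apply`, ✓`bondEquiv_apply`).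
* `slice_adBond_eq_adSite_slice` — under the two formula clauses of ✓`exists_adIsometries` for `σ`: `S_ν(Ψ_σA) = Φ_σ(S_νA)` (source conjugation of a one-form = site conjugation of
  its components; `rfl` on the formulas).
* ★ `norm_equiv_DL2_slice_gaugeAct_eq` — `‖(D_{U₀^σ}(S_ν(D_{U₀^σ}Φ_σu)))(p)‖ = ‖(D_{U₀}(S_ν(D_{U₀}u)))(p)‖` (intertwining `D_{U₀^σ}Φ = ΨD_{U₀}` + the slice intertwining + the pointwise
  identity of ✓`exists_adIsometries_pointwise`).
* ★ `norm_plaqU_bgOfCfg_sub_one_le` — on `RegPr F n K ε₀ V`: `‖plaqU (shiftEquiv) (bgOfCfg V) κ ν y − 1‖ ≤ ε₀·η²` for ALL `κ ν y` (`κ < ν`: ✓`norm_plaqHolU_bgOfCfg_sub_one_lt` through lit's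
  `rfl` junction ✓`plaqHolU_eq_plaqU`; `κ = ν`: trivial loop; `κ > ν`: ✓`plaqU_swap` + `U1` ✓`norm_inv_sub_one_le`, ✓`bgOfCfg_mem_U1`).
* ★ `norm_J_bgOfCfg_le` — on `RegPr F n K ε₀ V`: `‖J (shiftEquiv) (bgOfCfg V) η μ y‖ ≤ ε₀` (`J = η⁻³·J₁` ✓`Prop7ActionGradCurrent.J_Tsh_bgOfCfg_eq`; `J₁ = Im(D^{1*}_V∂V)` lit
  ✓`J_eq_imPart_div` + ✓`Node00.covDivT_eq_divPη`; `‖Im X‖ ≤ ‖X‖`; `DivSmall`: `‖(D^{1*}_V∂V)(b)‖ < ε₀η³`, `η³ = (L⁻¹)^{3(K−n)}` ✓`eta_pow`).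
HYP-SAT (★★OWNER RULING №42).  Hypotheses are `RegPr` (inhabited: print's (8)) and the formula∕intertwining clauses of ✓`exists_adIsometries_pointwise` (inhabited by that theorem for
every `σ`); conclusions are equalities∕real inequalities between displayed terms; no `Prop` hypothesis restates them.  HONEST SCOPE: dictionary glue over landed rows; no estimate of
print is proved here; nothing of H7's row, `h3`, norm_G, EX, 19200 or the rung; the Yang–Mills mass gap is NOT proved.

References: T. Bałaban, CMP **99** (1985) 389–434 [Balaban1985BackgroundPropagators] ((3.1)–(3.3) pp.390–391, (3.5) p.391, (3.8)–(3.11) p.392, (3.23) p.394, (3.35) p.396);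
CMP **102** (1985) 277–309 [Balaban1985Variational] ((2), (8) p.278, (19) p.281, (28) p.282); CMP **102** (1985) 255–275 [Balaban1985RegularSpaces] ((1.2) p.76, (1.9) p.77).
-/

set_option autoImplicit false

noncomputable section

open scoped BigOperators Matrix.Norms.L2Operator InnerProductSpace ComplexConjugate

namespace Summit.QuantumFields.YangMills.Theorems.Prop7SolutionHessianLetters


open Literature.MathematicalPhysics.QuantumFieldTheory.Balaban1983to89
open Literature.MathematicalPhysics.QuantumFieldTheory.Balaban1983to89.T3ContinuumYM3Torus
open B10Eq27TorusAxialLog (axialT unitsField toUField)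
open B4Sect5Torus (TSite tdist tdist_self tdist_nonneg)
open B9SectCLatticeCarrier (Bond shift tdist_shift_le)
open B9Eq33CovDerivVector (shiftEquiv)
open B9Eq39Adjoint (plaqU J)
open B9Eq311L2Pairing (WL2)
open B9TorusCalculus (torusT)
open B11Eq103H1Complex (SiteL2K BondL2K)
open B7Prop1Explicit (U1)
open B9Eq310DeltaPrimeJunction (plaqHolU_eq_plaqU)
open B9Eq3117Current (plaqU_swap)
open B11Eq27Current (imPart J_eq_imPart_div norm_imPart_le)
open T3RegularMinimiser (regThreshold)
open T3PrintedRegularMinimiser (RegPr)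
open T3PrintedRegularOrbits (regPr_gaugeAct_iff)
open T3SectALandauChart (eta eta_pos eta_pow formComp covGradT bgUnits)
open Summit.QuantumFields.YangMills.Theorems.Prop7SectET3Transport (periodsT3 siteEquiv bondEquiv bondEquiv_apply bgOfCfg)
open Summit.QuantumFields.YangMills.Theorems.Prop7SectET3HilbertLetters (W₂ frobEquiv toL2 toL2S DL2 DstarL2 covLapSite toL2_apply toL2S_apply toL2_symm_apply)
open Summit.QuantumFields.YangMills.Theorems.Prop7TwoBackgroundGradientComparison (one_le_periodsT3 norm_DL2_le)
open Summit.QuantumFields.YangMills.Theorems.Prop7CurvedMemberLocalHessian (exists_curved_localHessian)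
open Summit.QuantumFields.YangMills.Theorems.Prop7WeightedGradientAbsorption (weighted_sup_absorption)
open Summit.QuantumFields.YangMills.Theorems.Prop7GaugeCovariancePointwise (exists_adIsometries_pointwise ell_mul_norm_sub_le_of_rows covLapSite_gaugeAct_eq_of_eq)
open Summit.QuantumFields.YangMills.Theorems.AxialGaugeChartGlue (norm_bgOfCfg_axialT_sub_le)
open Summit.QuantumFields.YangMills.Theorems.Prop7CurvedMemberBallLetters (natCast_radius norm_bgOfCfg_axialT_sub_one_le_of_ball ell_mul_delta_ball_le ell_mul_theta_ball_le)
open Summit.QuantumFields.YangMills.Theorems.Prop7SectET3WCurrentProp4Rows (bgOfCfg_mem_U1 norm_plaqHolU_bgOfCfg_sub_one_lt)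
open B10Eq68TorusRegularity (covDivT)
open Summit.QuantumFields.YangMills.Theorems.Prop7ActionGradCurrent (J_Tsh_bgOfCfg_eq)
open Summit.QuantumFields.YangMills.Theorems.Prop7SectET3DeltaEtaExplicit (val_inv_bgUnits_eq_star)
open Summit.QuantumFields.YangMills.Theorems.Prop7RieszTauFrobNorm (norm_frobEquiv_le)
open Summit.QuantumFields.YangMills.Theorems.Prop7LandauDict (DL2_toL2S_eq_covDerivFwdT)

variable (F : T3Family) (n K : ℕ) (c₀ : ℝ) [Fact (0 < c₀)]

/-! ## §1 Glue: the `ν`-slice of a bond field; gauge invariance of the Hessian entries; the plaquette and current letters of `RegPr` on the carrier -/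

omit [Fact (0 < c₀)] in
/-- **THE SLICE READS THE COMPONENT**: `(S_ν A)(y) = A(y, ν)` for `S_ν A := toL2S (formComp (toL2⁻¹ A) ν)`. [cite: Balaban1985Variational, (19) p.281] -/
theorem equiv_slice_apply (A : BondL2K ℂ 3 (periodsT3 F K) c₀ W₂) (ν : Fin 3) (y : TSite 3 (periodsT3 F K)) :
    WL2.equiv ℂ (fun _ : TSite 3 (periodsT3 F K) => c₀) W₂ (toL2S F K c₀ (formComp ((toL2 F K c₀).symm A) ν)) y
      = WL2.equiv ℂ (fun _ : Bond 3 (periodsT3 F K) => c₀) W₂ A (y, ν) := by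
  rw [toL2S_apply]
  show frobEquiv.symm ((toL2 F K c₀).symm A ⟨(siteEquiv F K).symm y, ν⟩) = _
  rw [toL2_symm_apply, bondEquiv_apply, LinearEquiv.symm_apply_apply]
  show WL2.equiv ℂ (fun _ : Bond 3 (periodsT3 F K) => c₀) W₂ A (siteEquiv F K ((siteEquiv F K).symm y), ν) = _
  rw [Equiv.apply_symm_apply]

/-- **SOURCE CONJUGATION OF A ONE-FORM = SITE CONJUGATION OF ITS COMPONENTS**: under the two formula clauses of ✓`exists_adIsometries` for a gauge transformation `σ`,
`S_ν(Ψ_σ A) = Φ_σ(S_ν A)`. [cite: Balaban1985BackgroundPropagators, (3.11) p.392, p.393] -/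
theorem slice_adBond_eq_adSite_slice (σ : GaugeTransf (F.P K) 0 (Matrix.specialUnitaryGroup (Fin 2) ℂ))
    (Φ : SiteL2K ℂ 3 (periodsT3 F K) c₀ W₂ ≃ₗᵢ[ℂ] SiteL2K ℂ 3 (periodsT3 F K) c₀ W₂)
    (Ψ : BondL2K ℂ 3 (periodsT3 F K) c₀ W₂ ≃ₗᵢ[ℂ] BondL2K ℂ 3 (periodsT3 F K) c₀ W₂)
    (hΦ : ∀ l : Site (F.P K) 0 → Matrix (Fin 2) (Fin 2) ℂ,
      Φ (toL2S F K c₀ l) = toL2S F K c₀ (fun x => (σ x : Matrix (Fin 2) (Fin 2) ℂ) * l x * star (σ x : Matrix (Fin 2) (Fin 2) ℂ)))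
    (hΨ : ∀ X : PBond (F.P K) 0 → Matrix (Fin 2) (Fin 2) ℂ,
      Ψ (toL2 F K c₀ X) = toL2 F K c₀ (fun b => (σ b.src : Matrix (Fin 2) (Fin 2) ℂ) * X b * star (σ b.src : Matrix (Fin 2) (Fin 2) ℂ)))
    (A : BondL2K ℂ 3 (periodsT3 F K) c₀ W₂) (ν : Fin 3) :
    toL2S F K c₀ (formComp ((toL2 F K c₀).symm (Ψ A)) ν) = Φ (toL2S F K c₀ (formComp ((toL2 F K c₀).symm A) ν)) := by
  obtain ⟨X, rfl⟩ : ∃ X, A = toL2 F K c₀ X := ⟨(toL2 F K c₀).symm A, (LinearEquiv.apply_symm_apply _ _).symm⟩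
  rw [hΨ, LinearEquiv.symm_apply_apply, LinearEquiv.symm_apply_apply, hΦ]
  rfl

/-- ★ **THE COVARIANT HESSIAN ENTRIES ARE GAUGE INVARIANT**: `‖(D_{U₀^σ}(S_ν(D_{U₀^σ}Φ_σu)))(p)‖ = ‖(D_{U₀}(S_ν(D_{U₀}u)))(p)‖` — the intertwining `D_{U₀^σ}Φ = ΨD_{U₀}`, the slice
intertwining, and the pointwise identity of ✓`exists_adIsometries_pointwise`. [cite: Balaban1985BackgroundPropagators, (3.3) p.391, (3.23) p.394, p.393] -/
theorem norm_equiv_DL2_slice_gaugeAct_eq (σ : GaugeTransf (F.P K) 0 (Matrix.specialUnitaryGroup (Fin 2) ℂ))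
    (U₀ : GaugeField (F.P K) 0 (Matrix.specialUnitaryGroup (Fin 2) ℂ))
    (Φ : SiteL2K ℂ 3 (periodsT3 F K) c₀ W₂ ≃ₗᵢ[ℂ] SiteL2K ℂ 3 (periodsT3 F K) c₀ W₂)
    (Ψ : BondL2K ℂ 3 (periodsT3 F K) c₀ W₂ ≃ₗᵢ[ℂ] BondL2K ℂ 3 (periodsT3 F K) c₀ W₂)
    (hΦ : ∀ l : Site (F.P K) 0 → Matrix (Fin 2) (Fin 2) ℂ,
      Φ (toL2S F K c₀ l) = toL2S F K c₀ (fun x => (σ x : Matrix (Fin 2) (Fin 2) ℂ) * l x * star (σ x : Matrix (Fin 2) (Fin 2) ℂ)))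
    (hΨ : ∀ X : PBond (F.P K) 0 → Matrix (Fin 2) (Fin 2) ℂ,
      Ψ (toL2 F K c₀ X) = toL2 F K c₀ (fun b => (σ b.src : Matrix (Fin 2) (Fin 2) ℂ) * X b * star (σ b.src : Matrix (Fin 2) (Fin 2) ℂ)))
    (hD : ∀ x, DL2 F n K c₀ (GaugeField.gaugeAct σ U₀) (Φ x) = Ψ (DL2 F n K c₀ U₀ x))
    (hDpt : ∀ (v : SiteL2K ℂ 3 (periodsT3 F K) c₀ W₂) (p : Bond 3 (periodsT3 F K)),
      ‖WL2.equiv ℂ (fun _ : Bond 3 (periodsT3 F K) => c₀) W₂ (DL2 F n K c₀ (GaugeField.gaugeAct σ U₀) (Φ v)) p‖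
        = ‖WL2.equiv ℂ (fun _ : Bond 3 (periodsT3 F K) => c₀) W₂ (DL2 F n K c₀ U₀ v) p‖)
    (u : SiteL2K ℂ 3 (periodsT3 F K) c₀ W₂) (ν : Fin 3) (p : Bond 3 (periodsT3 F K)) :
    ‖WL2.equiv ℂ (fun _ : Bond 3 (periodsT3 F K) => c₀) W₂
        (DL2 F n K c₀ (GaugeField.gaugeAct σ U₀) (toL2S F K c₀ (formComp ((toL2 F K c₀).symm (DL2 F n K c₀ (GaugeField.gaugeAct σ U₀) (Φ u))) ν))) p‖
      = ‖WL2.equiv ℂ (fun _ : Bond 3 (periodsT3 F K) => c₀) W₂ (DL2 F n K c₀ U₀ (toL2S F K c₀ (formComp ((toL2 F K c₀).symm (DL2 F n K c₀ U₀ u)) ν))) p‖ := by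
  rw [hD, slice_adBond_eq_adSite_slice F K c₀ σ Φ Ψ hΦ hΨ, hDpt]

/-- ★ **THE PLAQUETTE WINDOW OF `RegPr` ON THE CARRIER, ALL ORIENTATIONS**: `‖V(∂p_{κν}(y)) − 1‖ ≤ ε₀·η²` for every `κ ν y` (`κ < ν`: ✓`norm_plaqHolU_bgOfCfg_sub_one_lt` through lit's
`plaqHolU_eq_plaqU`; `κ = ν`: the trivial loop; `κ > ν`: the inverse holonomy, `U1`). [cite: Balaban1985Variational, (2) p.278; Balaban1985BackgroundPropagators, (3.1) p.390, (3.5) p.391, (3.35) p.396] -/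
theorem norm_plaqU_bgOfCfg_sub_one_le {ε₀ : ℝ} (V : GaugeField (F.P K) 0 (Matrix.specialUnitaryGroup (Fin 2) ℂ)) (hreg : RegPr F n K ε₀ V)
    (κ ν : Fin 3) (y : TSite 3 (periodsT3 F K)) :
    ‖((plaqU (fun μ => shiftEquiv (Pd := periodsT3 F K) μ) (fun μ y => bgOfCfg F K V (y, μ)) κ ν y : (Matrix (Fin 2) (Fin 2) ℂ)ˣ) : Matrix (Fin 2) (Fin 2) ℂ) - 1‖
      ≤ ε₀ * eta F n K ^ 2 := by
  have hlt : ∀ κ ν : Fin 3, κ < ν →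
      ‖((plaqU (fun μ => shiftEquiv (Pd := periodsT3 F K) μ) (fun μ y => bgOfCfg F K V (y, μ)) κ ν y : (Matrix (Fin 2) (Fin 2) ℂ)ˣ) : Matrix (Fin 2) (Fin 2) ℂ) - 1‖
        < ε₀ * eta F n K ^ 2 := by
    intro κ ν h
    have := norm_plaqHolU_bgOfCfg_sub_one_lt F hreg (y, ⟨(κ, ν), h⟩)
    rw [plaqHolU_eq_plaqU] at this
    exact this
  have hU1 : ∀ (κ : Fin 3) (z : TSite 3 (periodsT3 F K)), (fun μ y => bgOfCfg F K V (y, μ)) κ z ∈ U1 (Matrix (Fin 2) (Fin 2) ℂ) :=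
    fun κ z => bgOfCfg_mem_U1 F K V (z, κ)
  rcases lt_trichotomy κ ν with h | rfl | h
  · exact (hlt κ ν h).le
  · have h1 : plaqU (fun μ => shiftEquiv (Pd := periodsT3 F K) μ) (fun μ y => bgOfCfg F K V (y, μ)) κ κ y = 1 := by
      rw [plaqU]; group
    rw [h1, Units.val_one, sub_self, norm_zero]
    have h01 := hlt 0 1 (by decide)
    exact le_of_lt ((norm_nonneg _).trans_lt h01)
  · rw [plaqU_swap]
    have hmem : plaqU (fun μ => shiftEquiv (Pd := periodsT3 F K) μ) (fun μ y => bgOfCfg F K V (y, μ)) ν κ y ∈ U1 (Matrix (Fin 2) (Fin 2) ℂ) := by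
      rw [plaqU]
      exact (U1 _).mul_mem ((U1 _).mul_mem ((U1 _).mul_mem (hU1 _ _) (hU1 _ _)) ((U1 _).inv_mem (hU1 _ _))) ((U1 _).inv_mem (hU1 _ _))
    exact (B7Prop1Explicit.norm_inv_sub_one_le hmem).trans (hlt ν κ h).le

/-- ★ **THE CURRENT LETTER OF `RegPr` ON THE CARRIER**: `‖J_μ(y)‖ ≤ ε₀` for the current `J = D^{η*}(η⁻²Im ∂V)` of lit's calculus at the background of record `bgOfCfg F K V` and
spacing `η = L^{−(K−n)}` — `J = η⁻³·J₁` on the route lattice (✓`J_Tsh_bgOfCfg_eq`), `J₁ = Im (D^{1*}_V ∂V)` (lit ✓`J_eq_imPart_div` + ✓`covDivT_eq_divPη`), `‖Im X‖ ≤ ‖X‖`, and the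
divergence clause of (8): `‖(D^{1*}_V∂V)(b)‖ < ε₀·η³`. [cite: Balaban1985Variational, (2) p.278, (28) p.282; Balaban1985RegularSpaces, (1.2) p.76, (1.9) p.77] -/
theorem norm_J_bgOfCfg_le {ε₀ : ℝ} (V : GaugeField (F.P K) 0 (Matrix.specialUnitaryGroup (Fin 2) ℂ)) (hreg : RegPr F n K ε₀ V)
    (μ : Fin 3) (y : TSite 3 (periodsT3 F K)) :
    ‖J (fun μ => shiftEquiv (Pd := periodsT3 F K) μ) (fun μ y => bgOfCfg F K V (y, μ)) (eta F n K) μ y‖ ≤ ε₀ := by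
  obtain ⟨x, rfl⟩ : ∃ x : Site (F.P K) 0, siteEquiv F K x = y := ⟨(siteEquiv F K).symm y, Equiv.apply_symm_apply _ _⟩
  have hη : 0 < eta F n K := eta_pos F n K
  -- the carrier current is `η⁻³·` the unit-spacing route current
  have h1 := J_Tsh_bgOfCfg_eq (F := F) (K := K) V (eta F n K) μ x
  -- the unit-spacing route current is `Im` of the route divergence
  have h2 : J (torusT (F.P K) 0) (fun μ x => bgUnits F K V ⟨x, μ⟩) 1 μ x = imPart (covDivT 1 (unitsField (toUField V)) μ x) := by
    have htorus : B9Eq39Adjoint.divP (torusT (F.P K) 0) (fun μ x => bgUnits F K V ⟨x, μ⟩)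
        (B11Eq27Current.plaqField (torusT (F.P K) 0) (fun μ x => bgUnits F K V ⟨x, μ⟩)) μ x = covDivT 1 (unitsField (toUField V)) μ x := by
      have h := Node00.covDivT_eq_divPη 1 (bgUnits F K V) μ x
      rw [B9Eq39Adjoint.divPη, Complex.ofReal_one, inv_one, one_smul] at h
      exact h.symm
    have h := J_eq_imPart_div (torusT (F.P K) 0) (fun μ x => bgUnits F K V ⟨x, μ⟩) (val_inv_bgUnits_eq_star V) 1 μ x
    rw [B9Eq39Adjoint.divPη, htorus, Complex.ofReal_one, inv_one, one_pow, one_smul, one_smul] at h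
    exact h
  -- the divergence clause of (8)
  have h3 : ‖covDivT 1 (unitsField (toUField V)) μ x‖ < ε₀ * ((F.L : ℝ)⁻¹) ^ (3 * (K - n)) := hreg.divSmall ⟨x, μ⟩
  rw [← eta_pow] at h3
  have h4 : ‖J (fun μ => shiftEquiv (Pd := periodsT3 F K) μ) (fun μ y => bgOfCfg F K V (y, μ)) (eta F n K) μ (siteEquiv F K x)‖
      = (eta F n K)⁻¹ ^ 3 * ‖imPart (covDivT 1 (unitsField (toUField V)) μ x)‖ := by
    have e : J (fun μ => shiftEquiv (Pd := periodsT3 F K) μ) (fun μ y => bgOfCfg F K V (y, μ)) (eta F n K) μ (siteEquiv F K x)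
        = ((((eta F n K : ℝ) : ℂ)⁻¹) ^ 3) • imPart (covDivT 1 (unitsField (toUField V)) μ x) := by
      rw [← h2]; exact h1
    rw [e, norm_smul, norm_pow, norm_inv, Complex.norm_real, Real.norm_of_nonneg hη.le]
  rw [h4]
  calc (eta F n K)⁻¹ ^ 3 * ‖imPart (covDivT 1 (unitsField (toUField V)) μ x)‖
      ≤ (eta F n K)⁻¹ ^ 3 * (ε₀ * eta F n K ^ 3) :=
        mul_le_mul_of_nonneg_left ((norm_imPart_le _).trans h3.le) (by positivity)
    _ = ε₀ := by rw [inv_pow]; field_simp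

end Summit.QuantumFields.YangMills.Theorems.Prop7SolutionHessianLetters

end
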